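import Mathlib.Analysis.Calculus.BumpFunction.FiniteDimension
import Literature.Analysis.FunctionSpaces.WightmanFunctions
import HarnessLib

/-!
# The Streater–Wightman properties are hypotheses: counterexamples

`Literature.Analysis.FunctionSpaces.WightmanFunctions` lists the Streater–Wightman properties of
a family of tempered distributions `𝒲 : WightmanFamily d κ` — (a) relativistic invariance
`IsPoincareInvariantFamily 𝒲`, (b) spectral condition, (c) hermiticity `IsHermitianFamily 𝒲`,
(d) local commutativity, (e) positive definiteness `IsPositiveDefiniteFamily 𝒲`, (f) cluster
property `HasClusterProperty 𝒲`, and the normalisation `IsNormalisedFamily 𝒲` — as *predicates*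
on `𝒲` (each `def` takes `𝒲` through a section `variable`). They are the hypotheses (a)–(e),
the cluster property and `𝒲⁽⁰⁾ = 1` of the reconstruction theorem (Streater–Wightman (1964),
§3-4, Thm. 3-7, eqs. (3-42)–(3-47)), i.e. conditions on `𝒲`, not theorems about all families.
The theorems of the source attached to them — Thm. 3-1 (a), Thm. 3-2 (b)–(d), Thm. 3-3 (e),
Thm. 3-4: the vacuum expectation values *of a field theory* have these properties — are the
tree's `IsWightmanQFT.isPoincareInvariantFamily`, `IsWightmanQFT.isHermitianFamily`,
`IsWightmanQFT.isLocalFamily`, `IsWightmanQFT.isPositiveDefiniteFamily`,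
`IsWightmanQFT.isNormalisedFamily` (proved, `WightmanFunctionsFamilyProofs`) and the named facts
`IsWightmanQFT.hasSpectralCondition_family`, `IsWightmanQFT.hasClusterProperty_family`.

This file records, with proofs, that five of the seven predicates genuinely restrict `𝒲`, so
that none of them admits a closed `_holds` theorem. The witness is always a *scaled Dirac
family* `𝒲ₙ(F) = c · F(0)` (every degree `n`, every label tuple; built inside each proof from
`BoundedContinuousFunction.evalCLM` and `SchwartzMap.toBoundedContinuousFunctionCLM`):

* `not_forall_isPoincareInvariantFamily` — (a) fails for `c = 1` (nonempty label type): `δ₀` is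
  not translation invariant in degree one (tested on a smooth bump);
* `not_forall_isHermitianFamily` — (c) fails for `c = i` (degree `0`: `i ≠ conj i`);
* `not_forall_isPositiveDefiniteFamily` — (e) fails for `c = −1` (one degree-`0` test vector);
* `not_forall_hasClusterProperty` — (f) fails for `c = 2` when `0 < d` (so that spacelike
  vectors exist; for `d = 0` the condition is vacuous): `𝒲₀(1 ⊗ 1) = 2 ≠ 4 = 𝒲₀(1) 𝒲₀(1)`;
* `not_forall_isNormalisedFamily` — `𝒲₀ = 1` fails for `c = 0`.

Not treated here: (b) `HasSpectralCondition` (a counterexample needs a test function with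
Fourier transform supported off the spectral set) and (d) `IsLocalFamily` (vacuous for `d = 0`;
for `0 < d` a non-symmetric two-point evaluation works) — both are likewise predicates in `𝒲`.

## Sources

* R. F. Streater, A. S. Wightman, *PCT, Spin and Statistics, and All That* (Benjamin 1964;
  Princeton 2000 printing, `lit` key `book:streater2000-pct-spin-statistics-all-that`, same
  numbering), §3-3 Thms. 3-1 – 3-4, §3-4 Thm. 3-7 (a)–(e), eqs. (3-42)–(3-47).

## Mathlib / tree

`ContDiffBump` on a finite-dimensional space (`HasContDiffBump` instance of
`Mathlib.Analysis.Calculus.BumpFunction.FiniteDimension`), `HasCompactSupport.toSchwartzMap`,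
`SchwartzMap.toBoundedContinuousFunctionCLM` + `BoundedContinuousFunction.evalCLM` (the Dirac
functional as a `→L[ℂ]` map — Mathlib's `TemperedDistribution.delta` lives in the type synonym
`𝓢'(E, ℂ) = 𝓢(E, ℂ) →Lₚₜ[ℂ] ℂ`, whereas `WightmanFamily` is built on `→L[ℂ]`), `pi_norm_const`,
`PiLp.norm_single`, `tendsto_const_nhds_iff`, `Complex.le_def`; tree:
`SchwartzMap.constOfSubsingleton` (the test function `1` in degree `0`), `starTest_apply`,
`permTest_apply`, `translateMulti_apply`, `IsPoincareInvariantFamily.translation_invariant`,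
`minkowskiForm_self`, `ofTimeSpace`. No definitions are introduced.
-/

noncomputable section

open Filter
open scoped SchwartzMap ContDiff ComplexConjugate ComplexOrder Topology
open Literature.MathematicalPhysics.QuantumLattice

namespace Literature.Analysis.FunctionSpaces

variable {d : ℕ} {κ : Type*}

/-! ### (a) Relativistic invariance is a genuine restriction -/

/-- **Property (a) is not automatic.** For a nonempty label type, not every family of tempered
distributions is Poincaré invariant: the Dirac family `𝒲ₙ(F) = F(0)` violates translation
invariance in degree one — for a smooth bump `F` with `F(0) = 1` supported in the ball of radius
`2` and a translation `a` with `‖a‖ = 2`, `𝒲₁(F(· − a)) = F(−a) = 0 ≠ 1 = 𝒲₁(F)` — and translation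
invariance is the case `g = (a, 1)` of (a) (`IsPoincareInvariantFamily.translation_invariant`).
Hence `IsPoincareInvariantFamily`, hypothesis (a) of Streater–Wightman's Thm. 3-7 (eq. (3-42)),
holds for the Wightman distributions of a QFT (`IsWightmanQFT.isPoincareInvariantFamily`,
SW Thm. 3-1) but not for all families. [folklore] -/
theorem not_forall_isPoincareInvariantFamily [Nonempty κ] :
    ¬ ∀ 𝒲 : WightmanFamily d κ, IsPoincareInvariantFamily 𝒲 := by
  intro h
  obtain ⟨k₀⟩ := ‹Nonempty κ›
  -- the Dirac family `F ↦ F 0` in every degree, as `→L[ℂ]` maps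
  let δ : WightmanFamily d κ := fun n _ =>
    (BoundedContinuousFunction.evalCLM ℂ (0 : Fin n → SpaceTime d)).comp
      (SchwartzMap.toBoundedContinuousFunctionCLM ℂ (Fin n → SpaceTime d) ℂ)
  -- a smooth bump around the origin of `(ℝ^{1+d})^1`: `= 1` on the unit ball, `= 0` off radius 2
  let b : ContDiffBump (0 : Fin 1 → SpaceTime d) := ⟨1, 2, one_pos, one_lt_two⟩
  have hb_supp : HasCompactSupport fun x => ((b x : ℝ) : ℂ) :=
    b.hasCompactSupport.comp_left Complex.ofReal_zero
  have hb_smooth : ContDiff ℝ ∞ fun x => ((b x : ℝ) : ℂ) :=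
    Complex.ofRealCLM.contDiff.comp b.contDiff
  let F : 𝓢((Fin 1 → SpaceTime d), ℂ) := hb_supp.toSchwartzMap hb_smooth
  have h0 : F 0 = 1 := by
    change ((b 0 : ℝ) : ℂ) = 1
    rw [b.one_of_mem_closedBall (Metric.mem_closedBall_self b.rIn_pos.le)]
    exact Complex.ofReal_one
  -- the translation vector, of norm 2
  let a : SpaceTime d := EuclideanSpace.single 0 (2 : ℝ)
  have ha : ‖a‖ = 2 := by
    simp [a]
  have h1 : F (fun _ => -a) = 0 := by
    change ((b (fun _ => -a) : ℝ) : ℂ) = 0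
    rw [b.zero_of_le_dist]
    · exact Complex.ofReal_zero
    · change (2 : ℝ) ≤ dist (fun _ : Fin 1 => -a) 0
      rw [dist_zero_right, pi_norm_const, norm_neg, ha]
  have htr : translateMulti a F 0 = F (fun _ => -a) := by
    rw [translateMulti_apply]
    congr 1
    funext i
    simp
  -- translation invariance of `δ₀` in degree one, tested on `F`, gives `0 = 1`
  -- (`δ 1 k G = G 0` definitionally)
  have key : translateMulti a F 0 = F 0 := (h δ).translation_invariant 1 (fun _ => k₀) a F
  rw [htr, h1, h0] at key
  exact zero_ne_one key

/-- Equivalently: some family of tempered distributions violates property (a)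
(for a nonempty label type). [folklore] -/
theorem exists_not_isPoincareInvariantFamily [Nonempty κ] :
    ∃ 𝒲 : WightmanFamily d κ, ¬ IsPoincareInvariantFamily 𝒲 :=
  not_forall.1 not_forall_isPoincareInvariantFamily

/-! ### (c) Hermiticity is a genuine restriction -/

/-- **Property (c) is not automatic**: the Dirac family with weight `i`, `𝒲ₙ(F) = i F(0)`,
violates hermiticity in degree `0` — on the constant test function `1`, `𝒲₀(1*) = i` while
`conj 𝒲₀(1) = −i`. Hence `IsHermitianFamily` (hypothesis (c) of SW Thm. 3-7, eq. (3-45)) is a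
condition on `𝒲`. [folklore] -/
theorem not_forall_isHermitianFamily :
    ¬ ∀ 𝒲 : WightmanFamily d κ, IsHermitianFamily 𝒲 := by
  intro h
  let δ : WightmanFamily d κ := fun n _ =>
    Complex.I • (BoundedContinuousFunction.evalCLM ℂ (0 : Fin n → SpaceTime d)).comp
      (SchwartzMap.toBoundedContinuousFunctionCLM ℂ (Fin n → SpaceTime d) ℂ)
  have hδ : ∀ (n : ℕ) (k : Fin n → κ) (G : 𝓢((Fin n → SpaceTime d), ℂ)),
      δ n k G = Complex.I * G 0 := fun _ _ _ => rfl
  have key := h δ 0 Fin.elim0 (SchwartzMap.constOfSubsingleton 1)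
  rw [hδ 0 (Fin.elim0 ∘ Fin.rev), hδ 0 Fin.elim0] at key
  simp only [starTest_apply, permTest_apply, SchwartzMap.constOfSubsingleton_apply, map_one,
    mul_one, Complex.conj_I] at key
  -- key : I = -I
  have : (2 : ℂ) * Complex.I = 0 := by linear_combination key
  simp at this

/-! ### (e) Positive definiteness is a genuine restriction -/

/-- **Property (e) is not automatic**: the Dirac family with weight `−1`, `𝒲ₙ(F) = −F(0)`,
violates positive definiteness already for a single degree-`0` test vector `F₀ = 1`
(`𝒲₀(F₀* ⊗ F₀) = −1 < 0`). Hence `IsPositiveDefiniteFamily` (hypothesis (e) of SW Thm. 3-7,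
eq. (3-47)) is a condition on `𝒲`. [folklore] -/
theorem not_forall_isPositiveDefiniteFamily :
    ¬ ∀ 𝒲 : WightmanFamily d κ, IsPositiveDefiniteFamily 𝒲 := by
  intro h
  let δ : WightmanFamily d κ := fun n _ =>
    (-1 : ℂ) • (BoundedContinuousFunction.evalCLM ℂ (0 : Fin n → SpaceTime d)).comp
      (SchwartzMap.toBoundedContinuousFunctionCLM ℂ (Fin n → SpaceTime d) ℂ)
  have hδ : ∀ (n : ℕ) (k : Fin n → κ) (G : 𝓢((Fin n → SpaceTime d), ℂ)),
      δ n k G = -1 * G 0 := fun _ _ _ => rfl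
  -- one test vector of degree `0`: `F₀ = 1`, with `F₀* ⊗ F₀ = 1` (`Fin (0 + 0)` is `Fin 0`)
  let one : 𝓢((Fin 0 → SpaceTime d), ℂ) := SchwartzMap.constOfSubsingleton 1
  have hone : ∀ x, one x = 1 := fun _ => rfl
  have hG : ∀ i j : Fin 1, IsAppendTensorOf ((fun _ _ => one) i j)
      (starTest (permTest Fin.revPerm ((fun _ : Fin 1 => one) i))) ((fun _ : Fin 1 => one) j) := by
    intro i j x
    simp [hone]
  have key := h δ 1 (fun _ => 0) (fun _ => Fin.elim0) (fun _ => one) (fun _ _ => one) hG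
  simp only [Finset.univ_unique, Finset.sum_singleton] at key
  rw [hδ (0 + 0) (Fin.append (Fin.elim0 ∘ Fin.rev) Fin.elim0), hone, mul_one, Complex.le_def] at key
  norm_num at key

/-! ### (f) The cluster property is a genuine restriction -/

/-- A purely spatial nonzero vector is spacelike: `η((0, y), (0, y)) = −‖y‖² < 0` for
`y ≠ 0`. [folklore] -/
theorem isSpacelike_ofTimeSpace_zero {y : EuclideanSpace ℝ (Fin d)} (hy : y ≠ 0) :
    IsSpacelike (ofTimeSpace 0 y) := by
  unfold IsSpacelike
  rw [minkowskiForm_self, spaceC_ofTimeSpace, ofTimeSpace_apply_zero]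
  have : 0 < ‖y‖ := norm_pos_iff.2 hy
  nlinarith

/-- **Property (f) is not automatic** (for `0 < d`, so that spacelike vectors exist; for
`d = 0` the cluster condition is vacuous): the Dirac family with weight `2`, `𝒲ₙ(F) = 2 F(0)`,
violates the cluster decomposition property with `n = m = 0` — `𝒲₀(1 ⊗ 1_{(λa)}) = 2` for all
`λ`, while `𝒲₀(1) 𝒲₀(1) = 4`. Hence `HasClusterProperty` (the cluster hypothesis of SW Thm. 3-7)
is a condition on `𝒲`. [folklore] -/
theorem not_forall_hasClusterProperty (hd : 0 < d) :
    ¬ ∀ 𝒲 : WightmanFamily d κ, HasClusterProperty 𝒲 := by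
  intro h
  let δ : WightmanFamily d κ := fun n _ =>
    (2 : ℂ) • (BoundedContinuousFunction.evalCLM ℂ (0 : Fin n → SpaceTime d)).comp
      (SchwartzMap.toBoundedContinuousFunctionCLM ℂ (Fin n → SpaceTime d) ℂ)
  have hδ : ∀ (n : ℕ) (k : Fin n → κ) (G : 𝓢((Fin n → SpaceTime d), ℂ)),
      δ n k G = 2 * G 0 := fun _ _ _ => rfl
  -- a spacelike vector: the first spatial unit vector
  let y : EuclideanSpace ℝ (Fin d) := EuclideanSpace.single ⟨0, hd⟩ (1 : ℝ)
  have hy1 : ‖y‖ = 1 := by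
    simp [y]
  have hy : y ≠ 0 := by
    intro hy0
    rw [hy0, norm_zero] at hy1
    exact zero_ne_one hy1
  have ha : IsSpacelike (ofTimeSpace 0 y) := isSpacelike_ofTimeSpace_zero hy
  -- `1 ⊗ 1_{(ta)} = 1` in degree `0 + 0` (`Fin (0 + 0)` is `Fin 0`)
  let one : 𝓢((Fin 0 → SpaceTime d), ℂ) := SchwartzMap.constOfSubsingleton 1
  have hone : ∀ x, one x = 1 := fun _ => rfl
  have hH : ∀ t : ℝ, IsAppendTensorOf ((fun _ : ℝ => one) t) one
      (translateMulti (t • ofTimeSpace 0 y) one) := by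
    intro t x
    simp [hone, translateMulti_apply]
  have key := h δ 0 0 Fin.elim0 Fin.elim0 one one (ofTimeSpace 0 y) ha (fun _ => one) hH
  simp only [hδ, hone, mul_one, tendsto_const_nhds_iff] at key
  -- key : (2 : ℂ) = 2 * 2
  norm_num at key

/-! ### The normalisation is a genuine restriction -/

/-- **`𝒲₀ = 1` is not automatic**: the zero family has `𝒲₀(1) = 0 ≠ 1`. Hence
`IsNormalisedFamily` is a condition on `𝒲`. [folklore] -/
theorem not_forall_isNormalisedFamily :
    ¬ ∀ 𝒲 : WightmanFamily d κ, IsNormalisedFamily 𝒲 := by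
  intro h
  have key := h 0 Fin.elim0 (SchwartzMap.constOfSubsingleton 1)
  -- key : 0 = 1
  simp at key

end Literature.Analysis.FunctionSpaces
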